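import Literature.Computability.Cryptography.FGComplexityProofs
import Literature.Computability.Cryptography.WordRAMForward3
import HarnessLib

/-!
# Fine-grained complexity on the word RAM — transitivity of fine-grained reductions, proved

**V. Vassilevska Williams–R. Williams, J. ACM 65 (2018), §3, Prop. 1** (p. 27:10: "Let `A, B, C`
be problems so that `A ≤_q B` and `B ≤_q C`. Then `A ≤_q C`"; proof p. 27:11; also VVW ICM 2018,
Prop. 2.2), proved in the word-RAM rendering `FGReducible` of
`Literature.Computability.Cryptography.FGComplexity` for a common budget `n ^ q`, under the
hypotheses of the named fact `Literature.Computability.FineGrained.fgReducible_pow_trans_of_sizeFitsWord`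
(the three problems `IsStandard`, the size measure of `A` fitting in a word):
`FGReducible.trans_rpow_of_sizeFitsWord`.

The algorithm is the verified composed reduction `WordRAM.Inline.SIMF M₁ k₁ M₂ k₂` of
`Literature.Computability.Cryptography.WordRAMForward3`: the reduction `M₁` from `A` to `B` run at
a larger word size with relocated memory and emulated arithmetic, every oracle call answered by an
inline run of the reduction `M₂` from `B` to `D` whose own oracle calls are forwarded to the
`D`-oracle (loc. cit.: "replace each oracle call on an instance `xᵢ` … with a call to `P_{B,ε'}` on
`xᵢ`"). This file supplies, following `…FGComplexityProofs` (the transfer property): the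
`B`-oracle computed by `M₂` under a `D`-oracle together with its logged `D`-queries
(`exists_oracle_of_reduction`), the numeric side conditions for an explicit word-size constant
(`sim_numericsF`), the per-instance cost and ledger bounds (`sim_instanceF`; the ledger exponent
of the outer reduction is the inner `δ₂`, as in print: "Pick `ε = δ'`"), and the exponent
bookkeeping (`exists_budgetExponent`: the sub-polynomial overheads — `O(log W)` per query and the
prologue — are absorbed by `…FGComplexityProofs.exists_subExponent`).

## References

* V. Vassilevska Williams, R. R. Williams, *Subcubic equivalences between path, matrix, and
  triangle problems*, J. ACM 65 (2018), Art. 27, §3, Def. 3.1 and Prop. 1 (p. 27:10, proof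
  p. 27:11). doi:10.1145/3186893
* V. Vassilevska Williams, *On some fine-grained questions in algorithms and complexity*,
  Proc. ICM 2018, §2, Def. 2.1 and Prop. 2.2.
-/

namespace Literature.Computability.Cryptography

open WordRAM

/-! ## The oracle answered by a reduction -/

/-- **The oracle of a reduction.** If the deterministic oracle program `M_B`, run with the oracle
`O`, solves `B` within `T y` steps on every instance `y` (word size `k_B · width y`), its queries
being encodings of `D`-instances with ledger `≤ Λ y` and total length `≤ Λ' y`, then the function
`OB` sending a word list `q` to the output of `M_B` on `q` under `O` (and `[]` if `M_B` does not
halt on `q`) answers `B`; `M_B` computes `OB (B.encode y)` within `s (B.encode y) ≤ T y` steps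
(`s q` = the halting time on `q`) with query log `Dq (B.encode y)`, which is the list of encodings
of a list `dsOf y` of `D`-instances obeying the two bounds. [folklore] -/
theorem exists_oracle_of_reduction {B D : FGProblem} {MB : Program} {kB : ℕ} {T : B.Inst → ℕ}
    {O : List ℕ → List ℕ} {Λ Λ' : B.Inst → ℝ} {g : D.Inst → ℝ}
    (hMB : ∀ y, ∃ (c : Cfg) (ds : List D.Inst),
      HaltsWithin MB (kB * B.width y) O zeroCoins (B.encode y) (T y) c ∧ readOut c.mem ∈ B.Good y ∧
        c.queries = ds.map D.encode ∧ (ds.map g).sum ≤ Λ y ∧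
        ((ds.map fun z => (D.encode z).length).sum : ℝ) ≤ Λ' y) :
    ∃ (OB : List ℕ → List ℕ) (s : List ℕ → ℕ) (Dq : List ℕ → List (List ℕ))
      (dsOf : B.Inst → List D.Inst), B.OracleAnswers OB ∧
      ∀ y, s (B.encode y) ≤ T y ∧ Dq (B.encode y) = (dsOf y).map D.encode ∧
        ((dsOf y).map g).sum ≤ Λ y ∧ (((dsOf y).map fun z => (D.encode z).length).sum : ℝ) ≤ Λ' y ∧
        ∃ cB, HaltsWithin MB (kB * inputWidth (B.encode y)) O zeroCoins (B.encode y)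
          (s (B.encode y)) cB ∧ readOut cB.mem = OB (B.encode y) ∧ cB.queries = Dq (B.encode y) := by
  classical
  let Hal : List ℕ → Prop := fun q => ∃ t c, HaltsWithin MB (kB * inputWidth q) O zeroCoins q t c
  let OB : List ℕ → List ℕ := fun q => if h : Hal q then readOut h.choose_spec.choose.mem else []
  let s : List ℕ → ℕ := fun q => if h : Hal q then Nat.find h else 0
  let Dq : List ℕ → List (List ℕ) := fun q => if h : Hal q then h.choose_spec.choose.queries else []
  let dsOf : B.Inst → List D.Inst := fun y => (hMB y).choose_spec.choose
  have key : ∀ y, s (B.encode y) ≤ T y ∧ Dq (B.encode y) = (dsOf y).map D.encode ∧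
      ((dsOf y).map g).sum ≤ Λ y ∧ (((dsOf y).map fun z => (D.encode z).length).sum : ℝ) ≤ Λ' y ∧
      (∃ cB, HaltsWithin MB (kB * inputWidth (B.encode y)) O zeroCoins (B.encode y) (s (B.encode y)) cB ∧
        readOut cB.mem = OB (B.encode y) ∧ cB.queries = Dq (B.encode y)) ∧
      OB (B.encode y) ∈ B.Good y := by
    intro y
    obtain ⟨hev, hgood, hqs, hled, hlen⟩ := (hMB y).choose_spec.choose_spec
    set c := (hMB y).choose with hc
    have hcH : HaltsWithin MB (kB * inputWidth (B.encode y)) O zeroCoins (B.encode y) (T y) c := hev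
    have hH : Hal (B.encode y) := ⟨T y, c, hcH⟩
    have hs : s (B.encode y) = Nat.find hH := by simp only [s, dif_pos hH]
    have hO : OB (B.encode y) = readOut hH.choose_spec.choose.mem := by simp only [OB, dif_pos hH]
    have hD : Dq (B.encode y) = hH.choose_spec.choose.queries := by simp only [Dq, dif_pos hH]
    obtain ⟨cB, hcB⟩ := Nat.find_spec hH
    have h1 : cB = c := haltsWithin_unique_holds hcB hcH
    have h2 : hH.choose_spec.choose = c := haltsWithin_unique_holds hH.choose_spec.choose_spec hcH
    refine ⟨by rw [hs]; exact Nat.find_min' hH ⟨c, hcH⟩, by rw [hD, h2, hqs], hled, hlen,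
      ⟨cB, by rw [hs]; exact hcB, by rw [hO, h2, h1], by rw [hD, h2, h1]⟩, ?_⟩
    rw [hO, h2]; exact hgood
  exact ⟨OB, s, Dq, dsOf, fun y => (key y).2.2.2.2.2, fun y => ⟨(key y).1, (key y).2.1, (key y).2.2.1,
    (key y).2.2.2.1, (key y).2.2.2.2.1⟩⟩

/-! ## The word-size constant of the composed reduction -/

section numerics

/-- **The numeric side conditions of the composed reduction**, discharged for the word-size
constant `k' = k_B c₁ + m_B + c₁ + G + c₂ + 13`, the value bound `V = 2 ^ (c₁ w) - 1` of the outer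
reduction (`c₁ = G + C_o + k + m + 2`) and the value bound `V_B = 2 ^ (k_B c₁ w) + m_B + 2 ^ (c₂ w)`
of the inner one (`c₂ = G₂ + C_D + 2`), where `w ≥ 1` is the input width, `t ≤ 2 ^ (G w)` the time
of the outer reduction, `t₂ ≤ 2 ^ (G₂ w)` bounds the `D`-query lengths, `L < 2 ^ w` is the input
length, `m, m_B` the largest constants and `k, k_B` the word-size constants of the two reductions,
`C_o` the output constant of `B` and `C_D` that of `D`. [folklore] -/
theorem sim_numericsF {w G G₂ Co CoD k m kB mB t t₂ L c₁ c₂ k' : ℕ} (hw : 1 ≤ w)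
    (ht : t ≤ 2 ^ (G * w)) (ht₂ : t₂ ≤ 2 ^ (G₂ * w)) (hL : L < 2 ^ w)
    (hc₁ : c₁ = G + Co + k + m + 2) (hc₂ : c₂ = G₂ + CoD + 2)
    (hk' : k' = kB * c₁ + mB + c₁ + G + c₂ + 13) :
    w ≤ k' * w ∧ k * w < k' * w ∧ L + 83 ≤ Inline.Qv (k' * w) ∧
      m ≤ 2 ^ (c₁ * w) - 1 ∧ 1 ≤ 2 ^ (c₁ * w) - 1 ∧ 2 ^ (k * w) - 1 ≤ 2 ^ (c₁ * w) - 1 ∧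
      2 * (2 ^ (c₁ * w) - 1) + 121 ≤ Inline.Qv (k' * w) - 40 ∧
      kB * Nat.size (2 ^ (c₁ * w) - 1) < k' * w ∧
      2 ^ (kB * Nat.size (2 ^ (c₁ * w) - 1)) ≤ 2 ^ (kB * c₁ * w) + mB + 2 ^ (c₂ * w) ∧
      2 * (2 ^ (kB * c₁ * w) + mB + 2 ^ (c₂ * w)) + 2 ≤ Inline.Qv (k' * w) ∧
      t + 2 ≤ 2 ^ (k' * w) ∧ Co * t + Co ≤ 2 ^ (c₁ * w) - 1 ∧
      CoD * t₂ + CoD ≤ 2 ^ (kB * c₁ * w) + mB + 2 ^ (c₂ * w) := by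
  -- linear lower bounds for the products
  have hmono : ∀ {a b : ℕ}, a ≤ b → 2 ^ a ≤ 2 ^ b := fun h => Nat.pow_le_pow_right (by norm_num) h
  have hc₁w : c₁ * w = G * w + Co * w + k * w + m * w + 2 * w := by rw [hc₁]; ring
  have hc₂w : c₂ * w = G₂ * w + CoD * w + 2 * w := by rw [hc₂]; ring
  have hk'w : k' * w = kB * c₁ * w + mB * w + c₁ * w + G * w + c₂ * w + 13 * w := by rw [hk']; ring
  have hCow : Co ≤ Co * w := Nat.le_mul_of_pos_right _ hw
  have hCoDw : CoD ≤ CoD * w := Nat.le_mul_of_pos_right _ hw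
  have hkw : k ≤ k * w := Nat.le_mul_of_pos_right _ hw
  have hmw : m ≤ m * w := Nat.le_mul_of_pos_right _ hw
  have hmBw : mB ≤ mB * w := Nat.le_mul_of_pos_right _ hw
  -- powers
  have hP1 : 1 ≤ 2 ^ (c₁ * w) := Nat.one_le_two_pow
  have hP2 : 2 ^ 1 ≤ 2 ^ (c₁ * w) := hmono (by omega)
  have hQ : Inline.Qv (k' * w) = 2 ^ (k' * w - 2) := rfl
  have hsize : Nat.size (2 ^ (c₁ * w) - 1) ≤ c₁ * w := Nat.size_le.2 (by omega)
  have hkBs : kB * Nat.size (2 ^ (c₁ * w) - 1) ≤ kB * c₁ * w := by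
    rw [Nat.mul_assoc]; exact Nat.mul_le_mul_left _ hsize
  -- nonnegativity of the power atoms (for `omega`)
  have hA1 : 1 ≤ 2 ^ (kB * c₁ * w) := Nat.one_le_two_pow
  have hC1 : 1 ≤ 2 ^ (c₂ * w) := Nat.one_le_two_pow
  have hM1 : 1 ≤ 2 ^ mB := Nat.one_le_two_pow
  -- the inner value bound
  have hVB : 2 ^ (kB * c₁ * w) + mB + 2 ^ (c₂ * w) ≤ 2 ^ (kB * c₁ * w + mB + c₂ * w + 2) := by
    have h1 : mB + 1 ≤ 2 ^ mB := mB.lt_two_pow_self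
    have ha : 2 ^ (kB * c₁ * w) ≤ 2 ^ (kB * c₁ * w + mB + c₂ * w) := hmono (by omega)
    have hb : 2 ^ mB ≤ 2 ^ (kB * c₁ * w + mB + c₂ * w) := hmono (by omega)
    have hc : 2 ^ (c₂ * w) ≤ 2 ^ (kB * c₁ * w + mB + c₂ * w) := hmono (by omega)
    have hd : 2 ^ (kB * c₁ * w + mB + c₂ * w + 2) = 4 * 2 ^ (kB * c₁ * w + mB + c₂ * w) := by
      rw [Nat.pow_add]; ring
    omega
  refine ⟨by omega, by omega, ?_, ?_, by omega, ?_, ?_, by omega, ?_, ?_, ?_, ?_, ?_⟩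
  · -- `L + 83 ≤ Q`
    rw [hQ]
    have h1 : 2 ^ w + 83 ≤ 2 ^ (w + 7) := by
      rw [Nat.pow_add]; have : 1 ≤ 2 ^ w := Nat.one_le_two_pow; omega
    have h2 : 2 ^ (w + 7) ≤ 2 ^ (k' * w - 2) := hmono (by omega)
    omega
  · -- `m ≤ V`
    have h1 : m + 1 ≤ 2 ^ m := m.lt_two_pow_self
    have h2 : 2 ^ m ≤ 2 ^ (c₁ * w) := hmono (by omega)
    omega
  · -- `2 ^ (k w) - 1 ≤ V`
    have := hmono (show k * w ≤ c₁ * w by omega); omega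
  · -- `2 V + 121 ≤ Q - 40`
    rw [hQ]
    have h1 : 2 * (2 ^ (c₁ * w) - 1) + 161 ≤ 2 ^ (c₁ * w + 9) := by
      rw [Nat.pow_add]; omega
    have h2 : 2 ^ (c₁ * w + 9) ≤ 2 ^ (k' * w - 2) := hmono (by omega)
    omega
  · -- `2 ^ (kB size V) ≤ VB`
    have := hmono hkBs; omega
  · -- `2 VB + 2 ≤ Q`
    rw [hQ]
    have h2 : 2 * 2 ^ (kB * c₁ * w + mB + c₂ * w + 2) + 2 ≤ 2 ^ (kB * c₁ * w + mB + c₂ * w + 4) := by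
      rw [show kB * c₁ * w + mB + c₂ * w + 4 = (kB * c₁ * w + mB + c₂ * w + 2) + 2 by omega,
        Nat.pow_add _ (kB * c₁ * w + mB + c₂ * w + 2) 2]
      have : 1 ≤ 2 ^ (kB * c₁ * w + mB + c₂ * w + 2) := Nat.one_le_two_pow
      omega
    have h3 : 2 ^ (kB * c₁ * w + mB + c₂ * w + 4) ≤ 2 ^ (k' * w - 2) := hmono (by omega)
    omega
  · -- `t + 2 ≤ 2 ^ W`
    have h1 : 2 ^ (G * w) + 2 ≤ 2 ^ (G * w + 2) := by
      rw [Nat.pow_add]; have : 1 ≤ 2 ^ (G * w) := Nat.one_le_two_pow; omega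
    have h2 : 2 ^ (G * w + 2) ≤ 2 ^ (k' * w) := hmono (by omega)
    omega
  · -- `Co t + Co ≤ V`
    have h1 : Co * t + Co ≤ Co * (2 ^ (G * w) + 1) := by
      rw [Nat.mul_add, Nat.mul_one]; exact Nat.add_le_add_right (Nat.mul_le_mul_left _ ht) _
    have h2 : Co * (2 ^ (G * w) + 1) ≤ 2 ^ Co * 2 ^ (G * w + 1) :=
      Nat.mul_le_mul ((show Co + 1 ≤ 2 ^ Co from Co.lt_two_pow_self).trans' (Nat.le_succ _))
        (by rw [Nat.pow_succ]; have : 1 ≤ 2 ^ (G * w) := Nat.one_le_two_pow; omega)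
    have h3 : 2 ^ Co * 2 ^ (G * w + 1) = 2 ^ (Co + (G * w + 1)) := (Nat.pow_add _ _ _).symm
    have h4 : 2 ^ (Co + (G * w + 1)) ≤ 2 ^ (c₁ * w - 1) := hmono (by omega)
    have h5 : 2 ^ (c₁ * w - 1) < 2 ^ (c₁ * w) := Nat.pow_lt_pow_right (by norm_num) (by omega)
    omega
  · -- `CoD t₂ + CoD ≤ VB`
    have h1 : CoD * t₂ + CoD ≤ CoD * (2 ^ (G₂ * w) + 1) := by
      rw [Nat.mul_add, Nat.mul_one]; exact Nat.add_le_add_right (Nat.mul_le_mul_left _ ht₂) _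
    have h2 : CoD * (2 ^ (G₂ * w) + 1) ≤ 2 ^ CoD * 2 ^ (G₂ * w + 1) :=
      Nat.mul_le_mul ((show CoD + 1 ≤ 2 ^ CoD from CoD.lt_two_pow_self).trans' (Nat.le_succ _))
        (by rw [Nat.pow_succ]; have : 1 ≤ 2 ^ (G₂ * w) := Nat.one_le_two_pow; omega)
    have h3 : 2 ^ CoD * 2 ^ (G₂ * w + 1) = 2 ^ (CoD + (G₂ * w + 1)) := (Nat.pow_add _ _ _).symm
    have h4 : 2 ^ (CoD + (G₂ * w + 1)) ≤ 2 ^ (c₂ * w) := hmono (by omega)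
    omega

end numerics

/-! ## Lists: concatenated query logs and ledgers -/

/-- The concatenation of mapped lists is the map of the `flatMap`. [folklore] -/
theorem flatten_map_map_eq {α β γ : Type*} (l : List α) (f : α → List β) (g : β → γ) :
    (l.map fun a => (f a).map g).flatten = (l.flatMap f).map g := by
  induction l with
  | nil => rfl
  | cons a l ih => simp [ih]

/-- A sum over a `flatMap` is the sum of the inner sums. [folklore] -/
theorem sum_map_flatMap {α β M : Type*} [AddMonoid M] (l : List α) (f : α → List β) (g : β → M) :
    ((l.flatMap f).map g).sum = (l.map fun a => ((f a).map g).sum).sum := by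
  induction l with
  | nil => rfl
  | cons a l ih => simp [ih]

/-- A list sum bounded termwise by an affine form is bounded by the affine form of the sum and the
length. [folklore] -/
theorem sum_map_le_affine {ι : Type*} (l : List ι) (f g : ι → ℝ) (a b : ℝ)
    (hf : ∀ y ∈ l, f y ≤ a * g y + b) :
    (l.map f).sum ≤ a * (l.map g).sum + b * l.length := by
  induction l with
  | nil => simp
  | cons y l ih =>
    simp only [List.map_cons, List.sum_cons, List.length_cons, Nat.cast_succ]
    have h1 := hf y (by simp)
    have h2 := ih fun z hz => hf z (by simp [hz])
    nlinarith

/-! ## Growth rates -/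

/-- **From a sub-exponent to a budget exponent.** For `ε' > 0` there is `δ > 0` with
`n ^ (q - ε') ≤ (n ^ q) ^ (1 - δ) + 1` for all `n` (for `q > 0` take `δ = ε' / q`, equality up to
the `+ 1`; for `q ≤ 0` take `δ = 1`: the left side is at most `1`). [folklore] -/
theorem exists_budgetExponent {q ε' : ℝ} (hε' : 0 < ε') :
    ∃ δ : ℝ, 0 < δ ∧ ∀ n : ℕ, (n : ℝ) ^ (q - ε') ≤ ((n : ℝ) ^ q) ^ (1 - δ) + 1 := by
  rcases lt_or_ge 0 q with hq | hq
  · refine ⟨ε' / q, div_pos hε' hq, fun n => ?_⟩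
    rw [← Real.rpow_mul (Nat.cast_nonneg _), show q * (1 - ε' / q) = q - ε' by field_simp]
    linarith
  · refine ⟨1, one_pos, fun n => ?_⟩
    rw [sub_self, Real.rpow_zero]
    rcases Nat.eq_zero_or_pos n with rfl | hn
    · rw [Nat.cast_zero, Real.zero_rpow (by linarith)]; norm_num
    · have h1 : (1 : ℝ) ≤ n := by exact_mod_cast hn
      have := Real.rpow_le_one_of_one_le_of_nonpos h1 (show q - ε' ≤ 0 by linarith)
      linarith

/-- **The cost of the composed reduction is linear in a common majorant** `Y ≥ 1` of the powers
`X₁ = n^{q(1-δ_L)}` (input length), `X₂ = n^{q(1-δ₁)}` (budget of the outer reduction),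
`X₃ = n^{qη}` (bit size of the word size) and `X₃ X₂`: pure bookkeeping for
`FGReducible.trans_rpow_of_sizeFitsWord` (cf. `sim_cost_le_linear`). [folklore] -/
theorem sim_cost_le_linearF {CoA κ C' CL' D u L sW X₁ X₂ X₃ Y : ℝ}
    (hCoA : 0 ≤ CoA) (hκ : 0 ≤ κ) (hC' : 0 ≤ C') (hCL' : 0 ≤ CL')
    (hD : 0 ≤ D) (hu : 0 ≤ u) (hX₂ : 0 ≤ X₂) (hY : 1 ≤ Y) (h₁ : X₁ ≤ Y)
    (h₂ : X₂ ≤ Y) (h₃ : X₃ ≤ Y) (h₄ : X₃ * X₂ ≤ Y) (hL : L ≤ CL' * X₁ + CL')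
    (hsW : sW ≤ D * u * X₃ + (D * u + D)) :
    (20 + 6 * CoA) * L + 20 * sW * (1 + (C' * X₂ + C')) + κ * (C' * X₂ + C') + (615 + 6 * CoA) ≤
      ((20 + 6 * CoA) * (2 * CL') +
          20 * ((1 + C') * (2 * (D * u) + D) + C' * (D * u) + C' * (D * u + D)) +
          κ * (2 * C') + (615 + 6 * CoA)) * Y := by
  have hL' : L ≤ 2 * CL' * Y := by nlinarith [mul_le_mul_of_nonneg_left h₁ hCL']
  have hB : C' * X₂ + C' ≤ 2 * C' * Y := by nlinarith [mul_le_mul_of_nonneg_left h₂ hC']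
  have hDu : 0 ≤ D * u := mul_nonneg hD hu
  have hmid : sW * (1 + (C' * X₂ + C')) ≤
      ((1 + C') * (2 * (D * u) + D) + C' * (D * u) + C' * (D * u + D)) * Y := by
    have h1 : sW * (1 + (C' * X₂ + C')) ≤ (D * u * X₃ + (D * u + D)) * (1 + (C' * X₂ + C')) :=
      mul_le_mul_of_nonneg_right hsW (by positivity)
    have hexp : (D * u * X₃ + (D * u + D)) * (1 + (C' * X₂ + C')) =
        (1 + C') * (D * u * X₃ + (D * u + D)) + C' * (D * u) * (X₃ * X₂) +
          C' * (D * u + D) * X₂ := by ring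
    rw [hexp] at h1
    have p1 := mul_le_mul_of_nonneg_left h₃ hDu
    have p2 := mul_le_mul_of_nonneg_left h₄ (mul_nonneg hC' hDu)
    have p3 := mul_le_mul_of_nonneg_left h₂ (mul_nonneg hC' (add_nonneg hDu hD))
    have p4 : (1 + C') * (D * u * X₃ + (D * u + D)) ≤ (1 + C') * ((2 * (D * u) + D) * Y) := by
      refine mul_le_mul_of_nonneg_left ?_ (by positivity)
      nlinarith
    nlinarith
  have q1 := mul_le_mul_of_nonneg_left hL' (show (0 : ℝ) ≤ 20 + 6 * CoA by positivity)
  have q2 := mul_le_mul_of_nonneg_left hmid (show (0 : ℝ) ≤ 20 by norm_num)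
  have q3 := mul_le_mul_of_nonneg_left hB hκ
  have q4 : (615 + 6 * CoA) ≤ (615 + 6 * CoA) * Y := by
    have : (0 : ℝ) ≤ 615 + 6 * CoA := by positivity
    nlinarith
  nlinarith


/-- A list sum bounded termwise by an affine form (natural numbers). [folklore] -/
theorem sum_map_le_affine_nat {ι : Type*} (l : List ι) (f g : ι → ℕ) (a b : ℕ)
    (hf : ∀ y ∈ l, f y ≤ a * g y + b) :
    (l.map f).sum ≤ a * (l.map g).sum + b * l.length := by
  induction l with
  | nil => simp
  | cons y l ih =>
    simp only [List.map_cons, List.sum_cons, List.length_cons, Nat.mul_add, Nat.mul_succ]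
    have h1 := hf y (by simp)
    have h2 := ih fun z hz => hf z (by simp [hz])
    omega

/-! ## The charge of one query of the outer reduction -/

/-- **The charge of one outer query**, bounded linearly: with the inner reduction computing `OB`
under `O` in `s` steps with logged `D`-queries `Dq (B.encode y) = (dsOf y).map D.encode`, answer
lengths affine in the query lengths (`C_oB`, `C_oD`), the charge of the query `B.encode y` is at most
`(20 + 16 C_oB) |B.encode y| + (85 + 11 C_oD) s + (14 + 11 C_oD) Σ_z |D.encode z| + (20 size W +
16 C_oB + 77)` (the number of `D`-queries is at most the number of steps `s`). [folklore] -/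
theorem chargeB_le {B D : FGProblem} {O OB : List ℕ → List ℕ} {s : List ℕ → ℕ}
    {Dq : List ℕ → List (List ℕ)} {dsOf : B.Inst → List D.Inst} {MB : Program} {kB CoB CoD W : ℕ}
    (hs : ∀ y, ∃ cB, HaltsWithin MB (kB * inputWidth (B.encode y)) O zeroCoins (B.encode y)
      (s (B.encode y)) cB ∧ readOut cB.mem = OB (B.encode y) ∧ cB.queries = Dq (B.encode y))
    (hDq : ∀ y, Dq (B.encode y) = (dsOf y).map D.encode)
    (hOB : ∀ y, (OB (B.encode y)).length ≤ CoB * (B.encode y).length + CoB)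
    (hOD : ∀ z, (O (D.encode z)).length ≤ CoD * (D.encode z).length + CoD) (y : B.Inst) :
    Inline.chargeB W O OB s Dq (B.encode y) ≤
      (20 + 16 * CoB) * (B.encode y).length + (85 + 11 * CoD) * s (B.encode y) +
        (14 + 11 * CoD) * ((dsOf y).map fun z => (D.encode z).length).sum +
        (20 * Nat.size W + 16 * CoB + 77) := by
  obtain ⟨cB, hcB, -, hqB⟩ := hs y
  have hcnt : (dsOf y).length ≤ s (B.encode y) := by
    obtain ⟨nB, hnB, hrunB, -⟩ := hcB.exists_run
    have h := run_queries_length nB hrunB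
    simp only [init_queries, List.length_nil, Nat.zero_add, hqB, hDq, List.length_map] at h
    omega
  have hpart : ((Dq (B.encode y)).map (Inline.chargeF O)).sum ≤
      (14 + 11 * CoD) * ((dsOf y).map fun z => (D.encode z).length).sum +
        (11 * CoD + 47) * (dsOf y).length := by
    rw [hDq, List.map_map]
    refine sum_map_le_affine_nat (dsOf y) (Inline.chargeF O ∘ D.encode) (fun z => (D.encode z).length)
      (14 + 11 * CoD) (11 * CoD + 47) fun z _ => ?_
    simp only [Function.comp, Inline.chargeF, Inline.qfCost]
    have h1 := hOD z
    have h2 : 11 * (O (D.encode z)).length ≤ 11 * (CoD * (D.encode z).length + CoD) :=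
      Nat.mul_le_mul_left _ h1
    rw [Nat.mul_add, ← Nat.mul_assoc] at h2
    nlinarith
  have hmul : (11 * CoD + 47) * (dsOf y).length ≤ (11 * CoD + 47) * s (B.encode y) :=
    Nat.mul_le_mul_left _ hcnt
  have hob := hOB y
  simp only [Inline.chargeB, Inline.qbCost]
  nlinarith

/-! ## The composed reduction on one instance -/

/-- **The composed reduction on one instance.** Given the outer reduction `M₁` (constant `C₁ ≥ 0`,
exponent `δ₁`, invoked at the ledger exponent `δ₂` of the inner one) run with the `B`-oracle `OB`
that the inner reduction `M₂` computes under the `D`-oracle `O` in time `s`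
(`s (B.encode y) ≤ C₂ (n_y ^ q) ^ (1 - δ₂) + 2 C₂`) with logged `D`-queries `dsOf y` of total length
`≤ C₂ (n_y ^ q) ^ (1 - δ₂) + C₂`, the output-length constants `C_oA, C_oB, C_oD` of the three
problems, and `A.size x < 2 ^ (K · width x)`, the composed reduction with word-size constant `k'`
run with `O` on `x` halts, within any `T` at least
`(20 + 6 C_oA) L + 20 · size (k' w) · (1 + B₀) + (135 + 32 C_oB + C₂ (283 + 55 C_oD)) B₀ + 615 + 6 C_oA`
(`L = |A.encode x|`, `w = A.width x`, `B₀ = C₁ (n ^ q) ^ (1 - δ₁) + C₁`), with an accepted output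
and with query log the encodings of the `D`-instances `bs.flatMap dsOf`, where the outer queries
`bs` obey the outer ledger and `|bs| ≤ B₀`. [folklore] -/
theorem sim_instanceF {A B D : FGProblem} {q δ₁ δ₂ C₁ C₂ : ℝ} {M₁ M₂ : Program}
    {k₁ k₂ K CoA CoB CoD : ℕ} {O OB : List ℕ → List ℕ} {s : List ℕ → ℕ}
    {Dq : List ℕ → List (List ℕ)} {dsOf : B.Inst → List D.Inst}
    (hdet₁ : M₁.IsDeterministic) (hdet₂ : M₂.IsDeterministic) (hC₁ : 0 ≤ C₁) (hC₂ : 0 ≤ C₂)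
    (hK : ∀ x, A.size x < 2 ^ (K * A.width x))
    (hs : ∀ y, ∃ cB, HaltsWithin M₂ (k₂ * inputWidth (B.encode y)) O zeroCoins (B.encode y)
      (s (B.encode y)) cB ∧ readOut cB.mem = OB (B.encode y) ∧ cB.queries = Dq (B.encode y))
    (hsT : ∀ y, (s (B.encode y) : ℝ) ≤ C₂ * ((B.size y : ℝ) ^ q) ^ (1 - δ₂) + 2 * C₂)
    (hDq : ∀ y, Dq (B.encode y) = (dsOf y).map D.encode)
    (hdsL : ∀ y, (((dsOf y).map fun z => (D.encode z).length).sum : ℝ) ≤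
      C₂ * ((B.size y : ℝ) ^ q) ^ (1 - δ₂) + C₂)
    (hOB : ∀ y, (OB (B.encode y)).length ≤ CoB * (B.encode y).length + CoB)
    (hOD : ∀ z, (O (D.encode z)).length ≤ CoD * (D.encode z).length + CoD)
    (hAout : ∀ x, ∀ out ∈ A.Good x, out.length ≤ CoA * (A.encode x).length + CoA)
    (hred : ∀ x, ∃ (c : Cfg) (bs : List B.Inst),
      HaltsWithin M₁ (k₁ * A.width x) OB zeroCoins (A.encode x)
          ⌊C₁ * ((A.size x : ℝ) ^ q) ^ (1 - δ₁) + C₁⌋₊ c ∧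
        readOut c.mem ∈ A.Good x ∧ c.queries = bs.map B.encode ∧
        (bs.map fun y => ((B.size y : ℝ) ^ q) ^ (1 - δ₂)).sum ≤
            C₁ * ((A.size x : ℝ) ^ q) ^ (1 - δ₁) + C₁ ∧
        ((bs.map fun y => (B.encode y).length).sum : ℝ) ≤ C₁ * ((A.size x : ℝ) ^ q) ^ (1 - δ₁) + C₁)
    {G G₂ c₁ c₂ k' : ℕ} (hG : G = ⌈C₁⌉₊ + ⌈q * (1 - δ₁)⌉₊ * K + 2) (hG₂ : G₂ = ⌈C₂⌉₊ + G + 1)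
    (hc₁ : c₁ = G + CoB + k₁ + Program.maxConst M₁ + 2) (hc₂ : c₂ = G₂ + CoD + 2)
    (hk' : k' = k₂ * c₁ + Program.maxConst M₂ + c₁ + G + c₂ + 13) (x : A.Inst) (T : ℕ)
    (hT : (20 + 6 * (CoA : ℝ)) * (A.encode x).length +
          20 * (Nat.size (k' * A.width x) : ℝ) * (1 + (C₁ * ((A.size x : ℝ) ^ q) ^ (1 - δ₁) + C₁)) +
          (135 + 32 * (CoB : ℝ) + C₂ * (283 + 55 * CoD)) * (C₁ * ((A.size x : ℝ) ^ q) ^ (1 - δ₁) + C₁) +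
          (615 + 6 * (CoA : ℝ)) ≤ (T : ℝ)) :
    ∃ (c : Cfg) (bs : List B.Inst),
      HaltsWithin (Inline.SIMF M₁ k₁ M₂ k₂) (k' * A.width x) O zeroCoins (A.encode x) T c ∧
      readOut c.mem ∈ A.Good x ∧ c.queries = (bs.flatMap dsOf).map D.encode ∧
      (bs.map fun y => ((B.size y : ℝ) ^ q) ^ (1 - δ₂)).sum ≤ C₁ * ((A.size x : ℝ) ^ q) ^ (1 - δ₁) + C₁ ∧
      (bs.length : ℝ) ≤ C₁ * ((A.size x : ℝ) ^ q) ^ (1 - δ₁) + C₁ := by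
  obtain ⟨c, bs, hHalt, hgood, hqs, hledger, hlen⟩ := hred x
  set w := A.width x with hwdef
  have hw1 : 1 ≤ w := A.width_pos x
  have hpow0 : (0 : ℝ) ≤ ((A.size x : ℝ) ^ q) ^ (1 - δ₁) :=
    Real.rpow_nonneg (Real.rpow_nonneg (Nat.cast_nonneg _) _) _
  have hB₀0 : 0 ≤ C₁ * ((A.size x : ℝ) ^ q) ^ (1 - δ₁) + C₁ := by positivity
  have htB : ((⌊C₁ * ((A.size x : ℝ) ^ q) ^ (1 - δ₁) + C₁⌋₊ : ℕ) : ℝ) ≤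
      C₁ * ((A.size x : ℝ) ^ q) ^ (1 - δ₁) + C₁ := Nat.floor_le hB₀0
  -- `B₀ ≤ N₁ ≤ 2 ^ (G w)`
  obtain ⟨N₁, hBN, hNG⟩ : ∃ N₁ : ℕ, C₁ * ((A.size x : ℝ) ^ q) ^ (1 - δ₁) + C₁ ≤ N₁ ∧ N₁ ≤ 2 ^ (G * w) := by
    have h1 : ((A.size x : ℝ) ^ q) ^ (1 - δ₁) ≤ ((2 ^ (⌈q * (1 - δ₁)⌉₊ * (K * w)) : ℕ) : ℝ) + 1 := by
      rw [← Real.rpow_mul (Nat.cast_nonneg _)]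
      exact rpow_natCast_le_two_pow (hK x) _
    generalize hP : 2 ^ (⌈q * (1 - δ₁)⌉₊ * (K * w)) = P at h1
    have hP1 : 1 ≤ P := by rw [← hP]; exact Nat.one_le_two_pow
    refine ⟨⌈C₁⌉₊ * (P + 2), ?_, ?_⟩
    · have hCc : C₁ ≤ ⌈C₁⌉₊ := Nat.le_ceil C₁
      have hP0 : (0 : ℝ) ≤ (P : ℝ) := Nat.cast_nonneg _
      have e1 : C₁ * ((A.size x : ℝ) ^ q) ^ (1 - δ₁) ≤ C₁ * ((P : ℝ) + 1) :=
        mul_le_mul_of_nonneg_left h1 hC₁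
      have e2 : C₁ * ((P : ℝ) + 2) ≤ (⌈C₁⌉₊ : ℝ) * ((P : ℝ) + 2) :=
        mul_le_mul_of_nonneg_right hCc (by linarith)
      push_cast
      linarith
    · have h4 : ⌈C₁⌉₊ * (P + 2) ≤ 2 ^ ⌈C₁⌉₊ * (4 * P) :=
        Nat.mul_le_mul ((show ⌈C₁⌉₊ + 1 ≤ 2 ^ ⌈C₁⌉₊ from Nat.lt_two_pow_self).trans' (Nat.le_succ _))
          (by omega)
      have h5 : 2 ^ ⌈C₁⌉₊ * (4 * P) ≤ 2 ^ (G * w) := by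
        rw [← hP, show 4 * 2 ^ (⌈q * (1 - δ₁)⌉₊ * (K * w)) = 2 ^ (⌈q * (1 - δ₁)⌉₊ * (K * w) + 2) by
          rw [Nat.pow_add]; ring, ← Nat.pow_add]
        refine Nat.pow_le_pow_right (by norm_num) ?_
        have hGw : G * w = ⌈C₁⌉₊ * w + ⌈q * (1 - δ₁)⌉₊ * (K * w) + 2 * w := by rw [hG]; ring
        have : ⌈C₁⌉₊ ≤ ⌈C₁⌉₊ * w := Nat.le_mul_of_pos_right _ hw1
        omega
      exact h4.trans h5
  have htG : ⌊C₁ * ((A.size x : ℝ) ^ q) ^ (1 - δ₁) + C₁⌋₊ ≤ 2 ^ (G * w) := by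
    have h3 : ⌊C₁ * ((A.size x : ℝ) ^ q) ^ (1 - δ₁) + C₁⌋₊ ≤ N₁ := by
      rw [← Nat.floor_natCast (R := ℝ) N₁]; exact Nat.floor_le_floor hBN
    exact h3.trans hNG
  -- make the budget and the time opaque
  generalize hB₀ : C₁ * ((A.size x : ℝ) ^ q) ^ (1 - δ₁) + C₁ = B₀ at hHalt hledger hlen hT hB₀0 htB htG hBN
  generalize ht : ⌊B₀⌋₊ = t at hHalt htB htG
  -- the bound on the `D`-query lengths: `t₂ ≤ 2 ^ (G₂ w)`
  set t₂ := ⌊C₂ * B₀ + C₂⌋₊ with ht₂def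
  have ht₂G : t₂ ≤ 2 ^ (G₂ * w) := by
    have hCc : C₂ ≤ ⌈C₂⌉₊ := Nat.le_ceil C₂
    have h1 : C₂ * B₀ + C₂ ≤ ((⌈C₂⌉₊ * (N₁ + 1) : ℕ) : ℝ) := by
      push_cast
      have e1 : C₂ * B₀ ≤ C₂ * N₁ := mul_le_mul_of_nonneg_left hBN hC₂
      have e2 : C₂ * ((N₁ : ℝ) + 1) ≤ (⌈C₂⌉₊ : ℝ) * ((N₁ : ℝ) + 1) :=
        mul_le_mul_of_nonneg_right hCc (by positivity)
      linarith
    have h2 : t₂ ≤ ⌈C₂⌉₊ * (N₁ + 1) := by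
      rw [ht₂def, ← Nat.floor_natCast (R := ℝ) (⌈C₂⌉₊ * (N₁ + 1))]; exact Nat.floor_le_floor h1
    have hGw1 : 1 ≤ 2 ^ (G * w) := Nat.one_le_two_pow
    have h3 : ⌈C₂⌉₊ * (N₁ + 1) ≤ 2 ^ ⌈C₂⌉₊ * 2 ^ (G * w + 1) :=
      Nat.mul_le_mul ((show ⌈C₂⌉₊ + 1 ≤ 2 ^ ⌈C₂⌉₊ from Nat.lt_two_pow_self).trans' (Nat.le_succ _))
        (by rw [Nat.pow_succ]; omega)
    have h4 : 2 ^ ⌈C₂⌉₊ * 2 ^ (G * w + 1) ≤ 2 ^ (G₂ * w) := by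
      rw [← Nat.pow_add]
      refine Nat.pow_le_pow_right (by norm_num) ?_
      have hG₂w : G₂ * w = ⌈C₂⌉₊ * w + G * w + w := by rw [hG₂]; ring
      have : ⌈C₂⌉₊ ≤ ⌈C₂⌉₊ * w := Nat.le_mul_of_pos_right _ hw1
      omega
    exact h2.trans (h3.trans h4)
  -- numerics
  obtain ⟨n2, n3, n4, n5, n6, n7, n8, n9, n10, n11, n12, n13, n14⟩ :=
    sim_numericsF (Co := CoB) (CoD := CoD) (k := k₁) (m := Program.maxConst M₁) (kB := k₂)
      (mB := Program.maxConst M₂) hw1 htG ht₂G (length_lt_two_pow_inputWidth (A.encode x)) hc₁ hc₂ hk'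
  -- the queries of the outer reduction
  have hmemq : ∀ q' ∈ c.queries, ∃ y ∈ bs, B.encode y = q' := fun q' hq => by
    rw [hqs] at hq; simpa [List.mem_map] using hq
  have hency : ∀ y ∈ bs, (B.encode y).length ≤ t := fun y hy => by
    rw [← ht]
    refine Nat.le_floor (le_trans ?_ hlen)
    have := List.le_sum_of_mem (List.mem_map_of_mem (f := fun y => (B.encode y).length) hy)
    exact_mod_cast this
  have hPy : ∀ y ∈ bs, ((B.size y : ℝ) ^ q) ^ (1 - δ₂) ≤ B₀ := fun y hy => by
    refine le_trans (List.single_le_sum (fun v hv => ?_) _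
      (List.mem_map_of_mem (f := fun y => ((B.size y : ℝ) ^ q) ^ (1 - δ₂)) hy)) hledger
    obtain ⟨y', -, rfl⟩ := List.mem_map.1 hv
    exact Real.rpow_nonneg (Real.rpow_nonneg (Nat.cast_nonneg _) _) _
  have hO : ∀ q' ∈ c.queries, (OB q').length ≤ 2 ^ (c₁ * w) - 1 := fun q' hq => by
    obtain ⟨y, hy, rfl⟩ := hmemq q' hq
    have := hOB y; have := hency y hy
    have : CoB * (B.encode y).length ≤ CoB * t := Nat.mul_le_mul_left _ this
    omega
  have hDlen : ∀ y ∈ bs, ∀ z ∈ dsOf y, (D.encode z).length ≤ t₂ := fun y hy z hz => by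
    rw [ht₂def]
    refine Nat.le_floor ?_
    have h1 := List.le_sum_of_mem (List.mem_map_of_mem (f := fun z => (D.encode z).length) hz)
    have h2 : (((D.encode z).length : ℕ) : ℝ) ≤ (((dsOf y).map fun z => (D.encode z).length).sum : ℕ) := by
      exact_mod_cast h1
    have h3 := hdsL y
    have h4 : C₂ * ((B.size y : ℝ) ^ q) ^ (1 - δ₂) ≤ C₂ * B₀ := mul_le_mul_of_nonneg_left (hPy y hy) hC₂
    linarith
  have hMB : ∀ q' ∈ c.queries, ∃ cB, HaltsWithin M₂ (k₂ * inputWidth q') O zeroCoins q' (s q') cB ∧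
      readOut cB.mem = OB q' ∧ cB.queries = Dq q' ∧
      ∀ q'' ∈ cB.queries, (O q'').length ≤ 2 ^ (k₂ * c₁ * w) + Program.maxConst M₂ + 2 ^ (c₂ * w) := by
    intro q' hq
    obtain ⟨y, hy, rfl⟩ := hmemq q' hq
    obtain ⟨cB, hcB, houtB, hqB⟩ := hs y
    refine ⟨cB, hcB, houtB, hqB, fun q'' hq'' => ?_⟩
    rw [hqB, hDq] at hq''
    obtain ⟨z, hz, rfl⟩ := List.mem_map.1 hq''
    have h1 := hOD z
    have h2 := hDlen y hy z hz
    have h3 : CoD * (D.encode z).length ≤ CoD * t₂ := Nat.mul_le_mul_left _ h2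
    omega
  have hbs : (bs.length : ℝ) ≤ B₀ := by
    obtain ⟨nM, hnM, hrunM, -⟩ := hHalt.exists_run
    have h1 := run_queries_length nM hrunM
    simp only [init_queries, List.length_nil, Nat.zero_add, hqs, List.length_map] at h1
    have : (bs.length : ℝ) ≤ t := by exact_mod_cast h1.trans hnM
    linarith
  -- the cost, in `ℝ`
  have hMBc : Program.maxConst M₂ ≤ 2 ^ (k₂ * c₁ * w) + Program.maxConst M₂ + 2 ^ (c₂ * w) :=
    (Nat.le_add_left _ _).trans (Nat.le_add_right _ _)
  have hcostT : Inline.simCost (A.encode x).length (k' * w) t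
      ((c.queries.map (Inline.chargeB (k' * w) O OB s Dq)).sum) (readOut c.mem).length ≤ T := by
    refine Nat.cast_le.1 (le_trans ?_ hT)
    have hsW0 : (0 : ℝ) ≤ (Nat.size (k' * w) : ℝ) := Nat.cast_nonneg _
    generalize hsW : (Nat.size (k' * w) : ℝ) = sW at hsW0
    have hℓ : ((readOut c.mem).length : ℝ) ≤ CoA * (A.encode x).length + CoA := by
      exact_mod_cast hAout x _ hgood
    -- the charges
    have hch : (((c.queries.map (Inline.chargeB (k' * w) O OB s Dq)).sum : ℕ) : ℝ) ≤
        (97 + 32 * (CoB : ℝ) + C₂ * (283 + 55 * CoD)) * B₀ + 20 * sW * B₀ := by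
      rw [Nat.cast_list_sum, List.map_map, hqs, List.map_map]
      have step := sum_map_le_linear bs
        (fun y => ((Inline.chargeB (k' * w) O OB s Dq (B.encode y) : ℕ) : ℝ))
        (fun y => ((B.encode y).length : ℝ)) (fun y => ((B.size y : ℝ) ^ q) ^ (1 - δ₂))
        (20 + 16 * CoB) (C₂ * (99 + 22 * CoD)) (20 * sW + 16 * CoB + 77 + C₂ * (184 + 33 * CoD))
        fun y _ => by
          have h0 : ((Inline.chargeB (k' * w) O OB s Dq (B.encode y) : ℕ) : ℝ) ≤
              (20 + 16 * (CoB : ℝ)) * (B.encode y).length + (85 + 11 * (CoD : ℝ)) * s (B.encode y) +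
                (14 + 11 * (CoD : ℝ)) * (((dsOf y).map fun z => (D.encode z).length).sum : ℕ) +
                (20 * (Nat.size (k' * w) : ℝ) + 16 * CoB + 77) := by
            exact_mod_cast chargeB_le hs hDq hOB hOD y
          rw [hsW] at h0
          have h1 := hsT y
          have h2 := hdsL y
          have hP0 : (0 : ℝ) ≤ ((B.size y : ℝ) ^ q) ^ (1 - δ₂) :=
            Real.rpow_nonneg (Real.rpow_nonneg (Nat.cast_nonneg _) _) _
          have hCoD : (0 : ℝ) ≤ CoD := Nat.cast_nonneg _
          have e1 : (85 + 11 * (CoD : ℝ)) * s (B.encode y) ≤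
              (85 + 11 * (CoD : ℝ)) * (C₂ * ((B.size y : ℝ) ^ q) ^ (1 - δ₂) + 2 * C₂) :=
            mul_le_mul_of_nonneg_left h1 (by positivity)
          have e2 : (14 + 11 * (CoD : ℝ)) * (((dsOf y).map fun z => (D.encode z).length).sum : ℕ) ≤
              (14 + 11 * (CoD : ℝ)) * (C₂ * ((B.size y : ℝ) ^ q) ^ (1 - δ₂) + C₂) :=
            mul_le_mul_of_nonneg_left h2 (by positivity)
          linarith
      have hsum1 : (bs.map fun y => ((B.encode y).length : ℝ)).sum ≤ B₀ := by
        have : (((bs.map fun y => (B.encode y).length).sum : ℕ) : ℝ) =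
            (bs.map fun y => ((B.encode y).length : ℝ)).sum := by rw [Nat.cast_list_sum, List.map_map]; rfl
        rw [← this]; exact hlen
      have hc1 : (0 : ℝ) ≤ 20 + 16 * CoB := by positivity
      have hc2 : (0 : ℝ) ≤ C₂ * (99 + 22 * CoD) := by positivity
      have hc3 : (0 : ℝ) ≤ 20 * sW + 16 * CoB + 77 + C₂ * (184 + 33 * CoD) := by positivity
      have e1 : (20 + 16 * (CoB : ℝ)) * (bs.map fun y => ((B.encode y).length : ℝ)).sum ≤
          (20 + 16 * CoB) * B₀ :=
        mul_le_mul_of_nonneg_left hsum1 hc1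
      have e2 : C₂ * (99 + 22 * (CoD : ℝ)) * (bs.map fun y => ((B.size y : ℝ) ^ q) ^ (1 - δ₂)).sum ≤
          C₂ * (99 + 22 * CoD) * B₀ :=
        mul_le_mul_of_nonneg_left hledger hc2
      have e3 : (20 * sW + 16 * CoB + 77 + C₂ * (184 + 33 * (CoD : ℝ))) * (bs.length : ℝ) ≤
          (20 * sW + 16 * CoB + 77 + C₂ * (184 + 33 * CoD)) * B₀ :=
        mul_le_mul_of_nonneg_left hbs hc3
      exact le_trans step (by linarith)
    -- total
    have hcost : ((Inline.simCost (A.encode x).length (k' * w) t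
        ((c.queries.map (Inline.chargeB (k' * w) O OB s Dq)).sum) (readOut c.mem).length : ℕ) : ℝ) =
        20 * (A.encode x).length + 20 * sW + 275 + 38 * t +
          (((c.queries.map (Inline.chargeB (k' * w) O OB s Dq)).sum : ℕ) : ℝ) +
          (6 * (readOut c.mem).length + 340) := by
      simp only [Inline.simCost, Inline.proCost, widthCost, Inline.epiCost, cstep]
      push_cast
      rw [hsW]
      ring
    rw [hcost, ← hsW]
    rw [← hsW] at hch
    have e4 : 0 ≤ (Nat.size (k' * w) : ℝ) * B₀ := mul_nonneg (Nat.cast_nonneg _) hB₀0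
    have hCoA : (0 : ℝ) ≤ CoA := Nat.cast_nonneg _
    linarith
  -- the simulation theorem
  obtain ⟨c', hc', hout', hq'⟩ := Inline.haltsWithin_SIMF hdet₁ hdet₂ n2 n3 n4 n5 n6 n7 n8 n9 n10 hMBc n11
    hHalt n12 hO hMB zeroCoins hcostT
  refine ⟨c', bs, hc', by rw [hout']; exact hgood, ?_, hledger, hbs⟩
  have hDqs : (bs.map B.encode).map Dq = bs.map fun y => (dsOf y).map D.encode := by
    rw [List.map_map]; exact List.map_congr_left fun y _ => by simp only [Function.comp, hDq]
  rw [hq', hqs, hDqs, flatten_map_map_eq]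


/-! ## The transitivity theorem -/

set_option maxHeartbeats 800000 in
/-- **VW–W J. ACM 2018, §3, Prop. 1 (transitivity of sub-`q` reductions), proved in the model**:
if `(A, n^q) ≤_FG (B, n^q)` and `(B, n^q) ≤_FG (D, n^q)`, the three problems are well formed and the
size measure of `A` fits in `O(1)` words, then `(A, n^q) ≤_FG (D, n^q)`. Given `ε`, take `δ₂` for
`B ≤ D` at `ε` and `δ₁` for `A ≤ B` at `ε₁ := δ₂` (loc. cit.: "Pick `ε = δ'`"); the algorithm is
the composed reduction `WordRAM.Inline.SIMF M₁ k₁ M₂ k₂` run with the `B`-oracle of `M₂` under the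
given `D`-oracle replaced by inline runs of `M₂` whose queries are forwarded; its time is bounded by
`sim_instanceF`, the `D`-ledger is the sum of the inner ledgers (`≤ C₂ Σᵢ (mᵢ^q)^{1-δ₂} + C₂ · #calls
≤ 2 C₂ (C₁ (n^q)^{1-δ₁} + C₁)`), and the exponent bookkeeping is `exists_subExponent` /
`exists_budgetExponent`. [cite: VassilevskaWilliamsWilliams2018, §3 Prop. 1 (p. 27:10, proof p. 27:11)] -/
theorem FGReducible.trans_rpow_of_sizeFitsWord {A B D : FGProblem} {q : ℝ}
    (hAB : FGReducible A (fun n => (n : ℝ) ^ q) B (fun n => (n : ℝ) ^ q))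
    (hBD : FGReducible B (fun n => (n : ℝ) ^ q) D (fun n => (n : ℝ) ^ q))
    (hA : A.IsStandard fun n => (n : ℝ) ^ q) (hB : B.IsStandard fun n => (n : ℝ) ^ q)
    (hD : D.IsStandard fun n => (n : ℝ) ^ q) (hsz : A.SizeFitsWord) :
    FGReducible A (fun n => (n : ℝ) ^ q) D (fun n => (n : ℝ) ^ q) := by
  intro ε hε
  classical
  -- the inner reduction at `ε`, the outer one at `ε₁ := δ₂`
  obtain ⟨δ₂, hδ₂, M₂, k₂, C₂, hdet₂, hM₂⟩ := hBD ε hε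
  obtain ⟨δ₁, hδ₁, M₁, k₁, C₁, hdet₁, hM₁⟩ := hAB δ₂ hδ₂
  -- the constants of well-formedness
  obtain ⟨CL, δL, hδL, hCL⟩ := hA.length_le
  obtain ⟨Cw, hCw⟩ := hA.width_le
  obtain ⟨_kA, CoA, hCoA⟩ := hA.hasWordOutputs
  obtain ⟨_kB, CoB, hCoB⟩ := hB.hasWordOutputs
  obtain ⟨_kD, CoD, hCoD⟩ := hD.hasWordOutputs
  obtain ⟨K, hK⟩ := hsz
  beta_reduce at hM₁ hM₂ hCL hCw
  -- positivised constants
  have hC₁' : 0 ≤ max C₁ 0 := le_max_right _ _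
  have hC₂' : 0 ≤ max C₂ 0 := le_max_right _ _
  have hCL' : 0 ≤ max CL 0 := le_max_right _ _
  have hCw' : 0 ≤ max Cw 0 := le_max_right _ _
  -- growth rates
  obtain ⟨η, hηdef⟩ : ∃ η : ℝ, η = min δ₁ 1 / 2 := ⟨_, rfl⟩
  have hη : 0 < η := by rw [hηdef]; positivity
  obtain ⟨Dc, hD0, hDc⟩ := exists_size_le_rpow hη
  obtain ⟨ε', hε', R, hR, hgrow⟩ := exists_subExponent hCw hK hδL hδ₁ hη
    (by rw [hηdef]; linarith [min_le_left δ₁ 1]) (by rw [hηdef]; linarith [min_le_right δ₁ 1])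
  obtain ⟨δ, hδ, hbud⟩ := exists_budgetExponent (q := q) hε'
  -- the word-size constant and the cost constant
  obtain ⟨G, hG⟩ : ∃ G : ℕ, G = ⌈max C₁ 0⌉₊ + ⌈q * (1 - δ₁)⌉₊ * K + 2 := ⟨_, rfl⟩
  obtain ⟨G₂, hG₂⟩ : ∃ G₂ : ℕ, G₂ = ⌈max C₂ 0⌉₊ + G + 1 := ⟨_, rfl⟩
  obtain ⟨c₁, hc₁⟩ : ∃ c₁ : ℕ, c₁ = G + CoB + k₁ + Program.maxConst M₁ + 2 := ⟨_, rfl⟩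
  obtain ⟨c₂, hc₂⟩ : ∃ c₂ : ℕ, c₂ = G₂ + CoD + 2 := ⟨_, rfl⟩
  obtain ⟨k', hk'⟩ : ∃ k' : ℕ, k' = k₂ * c₁ + Program.maxConst M₂ + c₁ + G + c₂ + 13 := ⟨_, rfl⟩
  obtain ⟨u, hu⟩ : ∃ u : ℝ, u = (2 * ((k' : ℝ) * max Cw 0)) ^ η := ⟨_, rfl⟩
  have hu0 : 0 ≤ u := by rw [hu]; exact Real.rpow_nonneg (by positivity) _
  obtain ⟨κ, hκ⟩ : ∃ κ : ℝ, κ = 135 + 32 * (CoB : ℝ) + max C₂ 0 * (283 + 55 * CoD) := ⟨_, rfl⟩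
  have hκ0 : 0 ≤ κ := by rw [hκ]; positivity
  obtain ⟨Γ, hΓ⟩ : ∃ Γ : ℝ, Γ = (20 + 6 * (CoA : ℝ)) * (2 * max CL 0) +
      20 * ((1 + max C₁ 0) * (2 * (Dc * u) + Dc) + max C₁ 0 * (Dc * u) + max C₁ 0 * (Dc * u + Dc)) +
      κ * (2 * max C₁ 0) + (615 + 6 * (CoA : ℝ)) := ⟨_, rfl⟩
  have hΓ0 : 0 ≤ Γ := by rw [hΓ]; positivity
  obtain ⟨Λ₀, hΛ₀⟩ : ∃ Λ₀ : ℝ, Λ₀ = 2 * max C₁ 0 * max C₂ 0 := ⟨_, rfl⟩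
  have hΛ₀0 : 0 ≤ Λ₀ := by rw [hΛ₀]; positivity
  obtain ⟨Cf, hCf⟩ : ∃ Cf : ℝ, Cf = (Γ + 2 * Λ₀ + 1) * (R + 2) := ⟨_, rfl⟩
  refine ⟨δ, hδ, Inline.SIMF M₁ k₁ M₂ k₂, k', Cf, Inline.SIMF_isDeterministic M₁ k₁ M₂ k₂,
    fun O hOans x => ?_⟩
  -- the `B`-oracle computed by `M₂` under `O`, with its logged `D`-queries
  obtain ⟨OB, s, Dq, dsOf, hOBans, hOBs⟩ := exists_oracle_of_reduction
    (g := fun z => ((D.size z : ℝ) ^ q) ^ (1 - ε)) (hM₂ O hOans)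
  -- the hypotheses of `sim_instanceF`
  have hs : ∀ y, ∃ cB, HaltsWithin M₂ (k₂ * inputWidth (B.encode y)) O zeroCoins (B.encode y)
      (s (B.encode y)) cB ∧ readOut cB.mem = OB (B.encode y) ∧ cB.queries = Dq (B.encode y) :=
    fun y => (hOBs y).2.2.2.2
  have hP0 : ∀ y : B.Inst, (0 : ℝ) ≤ ((B.size y : ℝ) ^ q) ^ (1 - δ₂) := fun y =>
    Real.rpow_nonneg (Real.rpow_nonneg (Nat.cast_nonneg _) _) _
  have hsT : ∀ y, (s (B.encode y) : ℝ) ≤ max C₂ 0 * ((B.size y : ℝ) ^ q) ^ (1 - δ₂) + 2 * max C₂ 0 := by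
    intro y
    have h1 : (s (B.encode y) : ℝ) ≤ ((⌊C₂ * ((B.size y : ℝ) ^ q) ^ (1 - δ₂) + C₂⌋₊ : ℕ) : ℝ) := by
      exact_mod_cast (hOBs y).1
    have h2 := natFloor_affine_le (C := C₂) (hP0 y)
    linarith
  have hDq : ∀ y, Dq (B.encode y) = (dsOf y).map D.encode := fun y => (hOBs y).2.1
  have hdsL : ∀ y, (((dsOf y).map fun z => (D.encode z).length).sum : ℝ) ≤
      max C₂ 0 * ((B.size y : ℝ) ^ q) ^ (1 - δ₂) + max C₂ 0 :=
    fun y => affine_le_affine_max (hOBs y).2.2.2.1 (hP0 y)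
  have hdsG : ∀ y, ((dsOf y).map fun z => ((D.size z : ℝ) ^ q) ^ (1 - ε)).sum ≤
      max C₂ 0 * ((B.size y : ℝ) ^ q) ^ (1 - δ₂) + max C₂ 0 :=
    fun y => affine_le_affine_max (hOBs y).2.2.1 (hP0 y)
  have hOBlen : ∀ y, (OB (B.encode y)).length ≤ CoB * (B.encode y).length + CoB :=
    fun y => (hCoB y _ (hOBans y)).1
  have hODlen : ∀ z, (O (D.encode z)).length ≤ CoD * (D.encode z).length + CoD :=
    fun z => (hCoD z _ (hOans z)).1
  have hAout : ∀ x, ∀ out ∈ A.Good x, out.length ≤ CoA * (A.encode x).length + CoA :=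
    fun x out hout => (hCoA x out hout).1
  have hred : ∀ x, ∃ (c : Cfg) (bs : List B.Inst),
      HaltsWithin M₁ (k₁ * A.width x) OB zeroCoins (A.encode x)
          ⌊max C₁ 0 * ((A.size x : ℝ) ^ q) ^ (1 - δ₁) + max C₁ 0⌋₊ c ∧
        readOut c.mem ∈ A.Good x ∧ c.queries = bs.map B.encode ∧
        (bs.map fun y => ((B.size y : ℝ) ^ q) ^ (1 - δ₂)).sum ≤
            max C₁ 0 * ((A.size x : ℝ) ^ q) ^ (1 - δ₁) + max C₁ 0 ∧
        ((bs.map fun y => (B.encode y).length).sum : ℝ) ≤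
            max C₁ 0 * ((A.size x : ℝ) ^ q) ^ (1 - δ₁) + max C₁ 0 := by
    intro x
    obtain ⟨c, bs, h1, h2, h3, h4, h5⟩ := hM₁ OB hOBans x
    have hle : C₁ * ((A.size x : ℝ) ^ q) ^ (1 - δ₁) + C₁ ≤
        max C₁ 0 * ((A.size x : ℝ) ^ q) ^ (1 - δ₁) + max C₁ 0 :=
      affine_le_affine_max le_rfl (Real.rpow_nonneg (Real.rpow_nonneg (Nat.cast_nonneg _) _) _)
    exact ⟨c, bs, h1.mono (Nat.floor_mono hle), h2, h3, h4.trans hle, h5.trans hle⟩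
  -- the exponent bookkeeping on `x`
  have hnq : 0 ≤ (A.size x : ℝ) ^ q := Real.rpow_nonneg (Nat.cast_nonneg _) _
  have hX0 : 0 ≤ ((A.size x : ℝ) ^ q) ^ (1 - δ) := Real.rpow_nonneg hnq _
  obtain ⟨Y, hY⟩ : ∃ Y : ℝ, Y = (A.size x : ℝ) ^ (q - ε') + R + 1 := ⟨_, rfl⟩
  have hP0' : 0 ≤ (A.size x : ℝ) ^ (q - ε') := Real.rpow_nonneg (Nat.cast_nonneg _) _
  have hY1 : 1 ≤ Y := by rw [hY]; linarith
  have hYX : Y ≤ ((A.size x : ℝ) ^ q) ^ (1 - δ) + (R + 2) := by rw [hY]; linarith [hbud (A.size x)]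
  have hgx := hgrow x
  have e1 : ((A.size x : ℝ) ^ q) ^ (1 - δL) = (A.size x : ℝ) ^ (q * (1 - δL)) :=
    (Real.rpow_mul (Nat.cast_nonneg _) _ _).symm
  have e2 : ((A.size x : ℝ) ^ q) ^ (1 - δ₁) = (A.size x : ℝ) ^ (q * (1 - δ₁)) :=
    (Real.rpow_mul (Nat.cast_nonneg _) _ _).symm
  have e3 : ((A.size x : ℝ) ^ q) ^ η = (A.size x : ℝ) ^ (q * η) :=
    (Real.rpow_mul (Nat.cast_nonneg _) _ _).symm
  have hX1 : ((A.size x : ℝ) ^ q) ^ (1 - δL) ≤ Y := by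
    rw [e1, hY]; linarith [hgx (q * (1 - δL)) (by simp)]
  have hX2 : ((A.size x : ℝ) ^ q) ^ (1 - δ₁) ≤ Y := by
    rw [e2, hY]; linarith [hgx (q * (1 - δ₁)) (by simp)]
  have hX3 : ((A.size x : ℝ) ^ q) ^ η ≤ Y := by
    rw [e3, hY]; linarith [hgx (q * η) (by simp)]
  have hX4 : ((A.size x : ℝ) ^ q) ^ η * ((A.size x : ℝ) ^ q) ^ (1 - δ₁) ≤ Y := by
    rw [e2, e3, hY]
    have := rpow_natCast_mul_rpow_le (A.size x) (q * η) (q * (1 - δ₁))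
    linarith [hgx (q * η + q * (1 - δ₁)) (by simp)]
  have hX20 : 0 ≤ ((A.size x : ℝ) ^ q) ^ (1 - δ₁) := Real.rpow_nonneg hnq _
  -- the input length, the width and the bit size of the target word size
  have hL : ((A.encode x).length : ℝ) ≤ max CL 0 * ((A.size x : ℝ) ^ q) ^ (1 - δL) + max CL 0 :=
    affine_le_affine_max (hCL x) (Real.rpow_nonneg hnq _)
  have hw : (A.width x : ℝ) ≤ max Cw 0 * (A.size x : ℝ) ^ q + max Cw 0 :=
    affine_le_affine_max (hCw x) hnq
  have hsW : (Nat.size (k' * A.width x) : ℝ) ≤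
      Dc * u * ((A.size x : ℝ) ^ q) ^ η + (Dc * u + Dc) := by
    have h1 := hDc (k' * A.width x)
    have h2 : ((k' * A.width x : ℕ) : ℝ) ≤
        (k' : ℝ) * max Cw 0 * (A.size x : ℝ) ^ q + (k' : ℝ) * max Cw 0 := by
      push_cast
      have := mul_le_mul_of_nonneg_left hw (Nat.cast_nonneg k')
      linarith
    have h3 : ((k' * A.width x : ℕ) : ℝ) ^ η ≤
        ((k' : ℝ) * max Cw 0 * (A.size x : ℝ) ^ q + (k' : ℝ) * max Cw 0) ^ η :=
      Real.rpow_le_rpow (Nat.cast_nonneg _) h2 hη.le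
    have h4 := rpow_affine_le (C := (k' : ℝ) * max Cw 0) (a := (A.size x : ℝ) ^ q) (η := η)
      (by positivity) hnq hη.le
    rw [← hu] at h4
    have h6 := mul_le_mul_of_nonneg_left (h3.trans h4) hD0
    linarith
  -- the time budget
  have hcost := sim_cost_le_linearF (Nat.cast_nonneg CoA) hκ0 hC₁' hCL' hD0 hu0 hX20 hY1 hX1 hX2 hX3 hX4 hL hsW
  rw [← hΓ] at hcost
  have hΓY : Γ * Y ≤ ((⌊Cf * ((A.size x : ℝ) ^ q) ^ (1 - δ) + Cf⌋₊ : ℕ) : ℝ) := by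
    have h1 := Nat.lt_floor_add_one (Cf * ((A.size x : ℝ) ^ q) ^ (1 - δ) + Cf)
    have h2 : Γ * Y ≤ Γ * (R + 2) * (((A.size x : ℝ) ^ q) ^ (1 - δ) + 1) := by
      have h3 := mul_le_mul_of_nonneg_left hYX hΓ0
      have h5 : ((A.size x : ℝ) ^ q) ^ (1 - δ) + (R + 2) ≤ (R + 2) * (((A.size x : ℝ) ^ q) ^ (1 - δ) + 1) := by
        nlinarith
      have h6 := mul_le_mul_of_nonneg_left h5 hΓ0
      linarith
    have h4 : Γ * (R + 2) * (((A.size x : ℝ) ^ q) ^ (1 - δ) + 1) + 1 ≤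
        Cf * ((A.size x : ℝ) ^ q) ^ (1 - δ) + Cf := by
      rw [hCf]
      have p1 : 0 ≤ (2 * Λ₀ + 1) * (R + 2) * ((A.size x : ℝ) ^ q) ^ (1 - δ) := by positivity
      have p2 : 2 ≤ (2 * Λ₀ + 1) * (R + 2) := by nlinarith
      linarith
    linarith
  obtain ⟨c, bs, hc, hgood, hqs, hled, hbs⟩ := sim_instanceF hdet₁ hdet₂ hC₁' hC₂' hK hs hsT hDq hdsL
    hOBlen hODlen hAout hred hG hG₂ hc₁ hc₂ hk' x ⌊Cf * ((A.size x : ℝ) ^ q) ^ (1 - δ) + Cf⌋₊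
    (by rw [← hκ]; exact hcost.trans hΓY)
  -- the ledger and the total query length
  have hB₀ : max C₁ 0 * ((A.size x : ℝ) ^ q) ^ (1 - δ₁) + max C₁ 0 ≤
      max C₁ 0 * (((A.size x : ℝ) ^ q) ^ (1 - δ) + (R + 3)) := by
    have := mul_le_mul_of_nonneg_left (hX2.trans hYX) hC₁'
    linarith
  have hfin : 2 * max C₂ 0 * (max C₁ 0 * ((A.size x : ℝ) ^ q) ^ (1 - δ₁) + max C₁ 0) ≤
      Cf * ((A.size x : ℝ) ^ q) ^ (1 - δ) + Cf := by
    have h1 := mul_le_mul_of_nonneg_left hB₀ (show 0 ≤ 2 * max C₂ 0 by positivity)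
    have h2 : 2 * max C₂ 0 * (max C₁ 0 * (((A.size x : ℝ) ^ q) ^ (1 - δ) + (R + 3))) =
        Λ₀ * ((A.size x : ℝ) ^ q) ^ (1 - δ) + Λ₀ * (R + 3) := by rw [hΛ₀]; ring
    have h3 : Λ₀ * ((A.size x : ℝ) ^ q) ^ (1 - δ) + Λ₀ * (R + 3) ≤
        Cf * ((A.size x : ℝ) ^ q) ^ (1 - δ) + Cf := by
      rw [hCf]
      have q1 : 0 ≤ (Γ + Λ₀ + 1) * (R + 2) * ((A.size x : ℝ) ^ q) ^ (1 - δ) := by positivity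
      have q2 : 0 ≤ Λ₀ * (R + 1) * ((A.size x : ℝ) ^ q) ^ (1 - δ) := by positivity
      have q3 : 0 ≤ (Γ + 1) * (R + 2) := by positivity
      have q4 : 0 ≤ Λ₀ * (R + 1) := by positivity
      linarith
    linarith
  have hsumG : ((bs.flatMap dsOf).map fun z => ((D.size z : ℝ) ^ q) ^ (1 - ε)).sum ≤
      2 * max C₂ 0 * (max C₁ 0 * ((A.size x : ℝ) ^ q) ^ (1 - δ₁) + max C₁ 0) := by
    rw [sum_map_flatMap]
    have step := sum_map_le_affine bs (fun y => ((dsOf y).map fun z => ((D.size z : ℝ) ^ q) ^ (1 - ε)).sum)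
      (fun y => ((B.size y : ℝ) ^ q) ^ (1 - δ₂)) (max C₂ 0) (max C₂ 0) fun y _ => hdsG y
    have e1 := mul_le_mul_of_nonneg_left hled hC₂'
    have e2 := mul_le_mul_of_nonneg_left hbs hC₂'
    linarith
  have hsumL : (((bs.flatMap dsOf).map fun z => (D.encode z).length).sum : ℝ) ≤
      2 * max C₂ 0 * (max C₁ 0 * ((A.size x : ℝ) ^ q) ^ (1 - δ₁) + max C₁ 0) := by
    rw [Nat.cast_list_sum, List.map_map, sum_map_flatMap]
    have step := sum_map_le_affine bs
      (fun y => ((dsOf y).map (fun z => ((D.encode z).length : ℝ))).sum)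
      (fun y => ((B.size y : ℝ) ^ q) ^ (1 - δ₂)) (max C₂ 0) (max C₂ 0) fun y _ => by
        have h := hdsL y
        rw [Nat.cast_list_sum, List.map_map] at h
        exact h
    have e1 := mul_le_mul_of_nonneg_left hled hC₂'
    have e2 := mul_le_mul_of_nonneg_left hbs hC₂'
    refine le_trans (le_of_eq ?_) (step.trans (by linarith))
    rfl
  exact ⟨c, bs.flatMap dsOf, hc, hgood, hqs, hsumG.trans hfin, hsumL.trans hfin⟩


/-- **Corollary (VW–W 2018, Cor. 3.1: `≡₃` is an equivalence relation — transitivity)**: subcubic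
equivalence is transitive for well-formed problems whose size measures fit in a word (both end
problems, one per direction). [cite: VassilevskaWilliamsWilliams2018, §3 Cor. 3.1 (p. 27:11)] -/
theorem SubcubicEquivalent.trans_of_sizeFitsWord {A B D : FGProblem}
    (hAB : SubcubicEquivalent A B) (hBD : SubcubicEquivalent B D)
    (hA : A.IsStandard fun n => (n : ℝ) ^ (3 : ℝ)) (hB : B.IsStandard fun n => (n : ℝ) ^ (3 : ℝ))
    (hD : D.IsStandard fun n => (n : ℝ) ^ (3 : ℝ)) (hAs : A.SizeFitsWord) (hDs : D.SizeFitsWord) :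
    SubcubicEquivalent A D :=
  ⟨FGReducible.trans_rpow_of_sizeFitsWord hAB.1 hBD.1 hA hB hD hAs,
    FGReducible.trans_rpow_of_sizeFitsWord hBD.2 hAB.2 hD hB hA hDs⟩

/-- Subquadratic equivalence is transitive for well-formed problems whose size measures fit in a
word (VVW ICM 2018, Prop. 2.2 with `a = b = n²`). [cite: VassilevskaWilliamsWilliams2018, §3 Cor. 3.1 (p. 27:11)] -/
theorem SubquadraticEquivalent.trans_of_sizeFitsWord {A B D : FGProblem}
    (hAB : SubquadraticEquivalent A B) (hBD : SubquadraticEquivalent B D)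
    (hA : A.IsStandard fun n => (n : ℝ) ^ (2 : ℝ)) (hB : B.IsStandard fun n => (n : ℝ) ^ (2 : ℝ))
    (hD : D.IsStandard fun n => (n : ℝ) ^ (2 : ℝ)) (hAs : A.SizeFitsWord) (hDs : D.SizeFitsWord) :
    SubquadraticEquivalent A D :=
  ⟨FGReducible.trans_rpow_of_sizeFitsWord hAB.1 hBD.1 hA hB hD hAs,
    FGReducible.trans_rpow_of_sizeFitsWord hBD.2 hAB.2 hD hB hA hDs⟩

end Literature.Computability.Cryptography
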